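import Summits.MatrixMultiplication.OmegaCensus.STPP211Z2pow6DirectChunks

/-!
# (2,1,1)¹⁰ ⊄ (ℤ/2)⁶ — part S2 class 04, decisions 4/4: direct search over the hard class #11 of `reps29` (roots d = 51, d = 55)

Cell `pub-omega` (unit `pub-omega-stpp-1-g37`), topic `Summits/MatrixMultiplication/OmegaCensus`.
HONEST FRAMING (verbatim): lottery ticket; floor = certified bounds/negative ranges. Census STRUCTURE bookkeeping (B5, `T1((ℤ/2)⁶)`, Pb237);
nothing here is a bound on `ω`.

Class #11 of `reps29` in the translated form `C' = hc04 = [0, 3, 5, 6, 7, 15, 23, 24, 39, 40]` (`+ 7`, block of `c = 7` first; linear stabilizer of order 48,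
root representatives [1, 8, 9, 11, 16, 17, 19, 48, 49, 51, 55]; HOME `pub-omega-stpp-1-g36/code/hard_perd.json`). The kernel evaluates the direct engine
(`STPP211Z2pow6DirectEngine.rootD`, soundness `noNF_of_rootD`) in CHUNKS of the root node (`STPP211Z2pow6DirectChunks.rootDX`, ≤ 10⁵ search
calls each, exact counts from the seat's C mirror `godc.c`; this file: 266,122 calls) and assembles `rootD C' d = true` per root by
`rootD_of_chunks`. The class theorem follows in `STPP211Z2pow6Hard04Class` (symmetry transport, `STPP211Z2pow6DirectTransport`).

References: H. Cohn, R. Kleinberg, B. Szegedy, C. Umans, FOCS 2005 (arXiv:math/0511460), Def. 5.1.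
-/

namespace Summit.MatrixMultiplication.OmegaCensus

namespace T1CosetEng

/-- KERNEL: root `d = 51`, chunk 1 (codes `x = 0 … 46` of the branching label's lane; 99,367 search calls). -/
theorem hc04_d51_c1 : rootDX [0, 3, 5, 6, 7, 15, 23, 24, 39, 40] 51 140737488355327 = true := by decide +kernel

/-- KERNEL: root `d = 51`, chunk 2 (codes `x = 47 … 63` of the branching label's lane; 2,399 search calls). -/
theorem hc04_d51_c2 : rootDX [0, 3, 5, 6, 7, 15, 23, 24, 39, 40] 51 18446603336221196288 = true := by decide +kernel

/-- KERNEL (assembled): the direct search from the root `A₀ = {0, dec 51}` refutes every normal-form family over `C'`. -/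
theorem hc04_d51 : rootD [0, 3, 5, 6, 7, 15, 23, 24, 39, 40] 51 = true :=
  rootD_of_chunks [0, 3, 5, 6, 7, 15, 23, 24, 39, 40] 51 [140737488355327, 18446603336221196288] (by decide) (cover_of_all64 _ (by decide)) (by
    intro M hM
    simp only [List.mem_cons, List.not_mem_nil, or_false] at hM
    rcases hM with rfl | rfl
    exacts [hc04_d51_c1, hc04_d51_c2])

/-- KERNEL: root `d = 55`, chunk 1 (codes `x = 0 … 21` of the branching label's lane; 97,013 search calls). -/
theorem hc04_d55_c1 : rootDX [0, 3, 5, 6, 7, 15, 23, 24, 39, 40] 55 4194303 = true := by decide +kernel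

/-- KERNEL: root `d = 55`, chunk 2 (codes `x = 22 … 63` of the branching label's lane; 67,341 search calls). -/
theorem hc04_d55_c2 : rootDX [0, 3, 5, 6, 7, 15, 23, 24, 39, 40] 55 18446744073705357312 = true := by decide +kernel

/-- KERNEL (assembled): the direct search from the root `A₀ = {0, dec 55}` refutes every normal-form family over `C'`. -/
theorem hc04_d55 : rootD [0, 3, 5, 6, 7, 15, 23, 24, 39, 40] 55 = true :=
  rootD_of_chunks [0, 3, 5, 6, 7, 15, 23, 24, 39, 40] 55 [4194303, 18446744073705357312] (by decide) (cover_of_all64 _ (by decide)) (by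
    intro M hM
    simp only [List.mem_cons, List.not_mem_nil, or_false] at hM
    rcases hM with rfl | rfl
    exacts [hc04_d55_c1, hc04_d55_c2])

end T1CosetEng

end Summit.MatrixMultiplication.OmegaCensus
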